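/-
Origin: expansion seat `planner-pub-hodgecm-pv14-g6-0`, handover import Pv14g6.SchwartzWeilLevi -> import HodgeCM.Automorphic.SchwartzWeilLevi ; after SchwartzWeilLevi (this seat row 1, same run) (`HOME/pub-hodgecm-pv14-g6/lean/Pv14g6/SchwartzWeilUnipotent.lean`, md5 02e2ba31, 361 lines);
landed by the gen-8 packager in gate run 30 as `HodgeCM/Automorphic/SchwartzWeilUnipotent.lean` (import ^import Pv14g6\.SchwartzWeilLevi[ \t]*$→import HodgeCM.Automorphic.SchwartzWeilLevi ×1).
-/
/-
Origin: `pub-hodgecm-pv14-g6/lean/Pv14g6/SchwartzWeilUnipotent.lean` — session planner-pub-hodgecm-pv14-g6-0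
(unit pub-hodgecm-pv14-g6, DAG-node prover #14, gen 6).  Intended final place:
`HodgeCM/Automorphic/SchwartzWeilUnipotent.lean` (namespace `HodgeCM.SchwartzWeil`).  NEW ADDITIVE LEAF.
PACKAGER: rewrite `import Pv14g6.SchwartzWeilLevi` to `import HodgeCM.Automorphic.SchwartzWeilLevi`.
Asserts nothing: no axioms, no unproved declarations.
-/
import Summits.HodgeConjecture.HodgeCM.Automorphic.SchwartzWeilLevi

/-!
# The Siegel unipotent radical of the Weil representation on `𝓢(V, ℂ)`: general symmetric chirps

The landed `SchwartzChirp` realises the SCALAR shears `n_t : (a, b, u) ↦ (a, b + t a, u 𝐞(-t‖a‖²/2))` by the chirps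
`𝐞(c‖x‖²)`.  Here the whole unipotent radical `N ≅ Sym(V)` of the Siegel parabolic is realised: for a SYMMETRIC operator
`Q` on `V` (`Q ∈ symOp V`, i.e. `⟪Q x, y⟫ = ⟪x, Q y⟫`)

* `Heis.unipQ Q : MulAut (Heis V)`, `n_Q (a, b, u) = (a, b + Q a, u · 𝐞(-⟪Q a, a⟫/2))` — a group automorphism BECAUSE `Q`
  is symmetric (`Heis.unipQFun_mul`), additive in `Q` (`Heis.unipQHom : Multiplicative (symOp V) →* MulAut (Heis V)`),
  fixing the centre; the scalar case is the landed one: `Heis.unip t = Heis.unipQ (t • 1)` (`Heis.unip_eq_unipQ`);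
* `chirpQ V Q : 𝓢(V, ℂ) →L[ℂ] 𝓢(V, ℂ)`, `Φ ↦ 𝐞(⟪Q x, x⟫/2) Φ` (any `Q : V →L[ℝ] V`; temperate growth from Mathlib's
  `ContinuousLinearMap.bilinear_hasTemperateGrowth`), additive in `Q`, with `chirpCLM V c = chirpQ V ((2 * c) • 1)`;
* **intertwining** `chirpQ V (m • Q) ∘ ρ_m(h) = ρ_m(n_Q h) ∘ chirpQ V (m • Q)` (`chirpQ_comp_repCLM`, `Q` symmetric), so
  `Q ↦ (n_Q, chirpQ (m • Q))` is a homomorphism `Sym(V) →* Mp_m(V)` (`unipQMp`, `intertwines_unipQ`), unique up to a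
  character of `Sym(V)` (`unipQ_unique_up_to_character`, from `SchwartzWeilProjective`);
* **the Siegel parabolic is a semidirect product inside `Aut(Heis V)`**: `λ_A n_Q λ_A⁻¹ = n_{ᵗA⁻¹ Q A⁻¹}`
  (`Heis.leviAut_mul_unipQ_mul_inv`), the Levi factor of `SchwartzWeilLevi` normalising `N`.

## References

* A. Weil, *Sur certains groupes d'opérateurs unitaires*, Acta Math. 111 (1964), n° 13, formulas (9)–(11).
* G. Lion, M. Vergne, *The Weil representation, Maslov index and theta series* (1980), Part I, §1.6, (2.2.6)–(2.2.8).
-/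

noncomputable section

open scoped SchwartzMap RealInnerProductSpace FourierTransform

namespace HodgeCM
namespace SchwartzWeil

/-! ## Symmetric operators -/

section Sym

variable (V : Type*) [NormedAddCommGroup V] [InnerProductSpace ℝ V]

/-- The symmetric (self-adjoint) operators on `V`, `Sym(V)`, as an `ℝ`-submodule of `V →L[ℝ] V`. -/
def symOp : Submodule ℝ (V →L[ℝ] V) where
  carrier := {Q | ∀ x y : V, ⟪Q x, y⟫ = ⟪x, Q y⟫}
  add_mem' := by
    intro Q Q' hQ hQ' x y
    simp only [add_apply, inner_add_left, inner_add_right, hQ x y, hQ' x y]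
  zero_mem' := by
    intro x y
    simp
  smul_mem' := by
    intro c Q hQ x y
    simp only [FunLike.coe_smul, Pi.smul_apply, real_inner_smul_left, real_inner_smul_right, hQ x y]

variable {V}

/-- (Ported verbatim from the HodgeCMPerL package; no docstring in the source.) -/
theorem mem_symOp_iff (Q : V →L[ℝ] V) : Q ∈ symOp V ↔ ∀ x y : V, ⟪Q x, y⟫ = ⟪x, Q y⟫ := Iff.rfl

/-- (Ported verbatim from the HodgeCMPerL package; no docstring in the source.) -/
theorem symOp.inner_apply_comm (Q : symOp V) (x y : V) : ⟪(Q : V →L[ℝ] V) x, y⟫ = ⟪x, (Q : V →L[ℝ] V) y⟫ :=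
  Q.2 x y

/-- (Ported verbatim from the HodgeCMPerL package; no docstring in the source.) -/
theorem symOp.inner_apply_comm' (Q : symOp V) (x y : V) : ⟪(Q : V →L[ℝ] V) x, y⟫ = ⟪(Q : V →L[ℝ] V) y, x⟫ := by
  rw [symOp.inner_apply_comm, real_inner_comm]

variable (V) in
/-- (Ported verbatim from the HodgeCMPerL package; no docstring in the source.) -/
theorem one_mem_symOp : (1 : V →L[ℝ] V) ∈ symOp V := fun _ _ => rfl

variable (V) in
/-- (Ported verbatim from the HodgeCMPerL package; no docstring in the source.) -/
theorem smul_one_mem_symOp (t : ℝ) : t • (1 : V →L[ℝ] V) ∈ symOp V := (symOp V).smul_mem t (one_mem_symOp V)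

end Sym

/-! ## The unipotent automorphisms `n_Q` of the Heisenberg group -/

namespace Heis

variable {V : Type*} [NormedAddCommGroup V] [InnerProductSpace ℝ V]

/-- The map underlying `n_Q`: `(a, b, u) ↦ (a, b + Q a, u 𝐞(-⟪Q a, a⟫/2))`. -/
def unipQFun (Q : V →L[ℝ] V) (h : Heis V) : Heis V := ⟨h.a, h.b + Q h.a, h.u * 𝐞 (-(⟪Q h.a, h.a⟫ / 2))⟩

/-- (Ported verbatim from the HodgeCMPerL package; no docstring in the source.) -/
@[simp] theorem unipQFun_a (Q : V →L[ℝ] V) (h : Heis V) : (unipQFun Q h).a = h.a := rfl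
/-- (Ported verbatim from the HodgeCMPerL package; no docstring in the source.) -/
@[simp] theorem unipQFun_b (Q : V →L[ℝ] V) (h : Heis V) : (unipQFun Q h).b = h.b + Q h.a := rfl
/-- (Ported verbatim from the HodgeCMPerL package; no docstring in the source.) -/
@[simp] theorem unipQFun_u (Q : V →L[ℝ] V) (h : Heis V) :
    (unipQFun Q h).u = h.u * 𝐞 (-(⟪Q h.a, h.a⟫ / 2)) := rfl

/-- (Ported verbatim from the HodgeCMPerL package; no docstring in the source.) -/
theorem unipQFun_add (Q Q' : V →L[ℝ] V) (h : Heis V) : unipQFun (Q + Q') h = unipQFun Q (unipQFun Q' h) := by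
  ext
  · rfl
  · simp only [unipQFun_b, unipQFun_a, add_apply]
    abel
  · simp only [unipQFun_u, unipQFun_a, add_apply, inner_add_left, mul_assoc,
      ← AddChar.map_add_eq_mul]
    ring_nf

/-- (Ported verbatim from the HodgeCMPerL package; no docstring in the source.) -/
theorem unipQFun_zero (h : Heis V) : unipQFun 0 h = h := by
  ext
  · rfl
  · simp
  · simp

/-- `n_Q` is multiplicative BECAUSE `Q` is symmetric. -/
theorem unipQFun_mul (Q : V →L[ℝ] V) (hQ : Q ∈ symOp V) (h h' : Heis V) :
    unipQFun Q (h * h') = unipQFun Q h * unipQFun Q h' := by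
  ext
  · simp only [unipQFun_a, mul_a]
  · simp only [unipQFun_b, mul_a, mul_b, map_add]
    abel
  · simp only [unipQFun_u, mul_u, mul_a, unipQFun_a, unipQFun_b, map_add, inner_add_left, inner_add_right]
    rw [mul_assoc (h.u * h'.u), ← AddChar.map_add_eq_mul, mul_mul_mul_comm, mul_assoc (h.u * h'.u),
      ← AddChar.map_add_eq_mul, ← AddChar.map_add_eq_mul, hQ h.a h'.a, real_inner_comm (Q h'.a) h.a]
    ring_nf

/-- **The unipotent automorphism** `n_Q (a, b, u) = (a, b + Q a, u 𝐞(-⟪Q a, a⟫/2))` of `Heis V` for a symmetric `Q` —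
conjugation by the symplectic shear `(x, y) ↦ (x, y + Q x)` lifted to the Heisenberg group. -/
def unipQ (Q : symOp V) : MulAut (Heis V) where
  toFun := unipQFun (Q : V →L[ℝ] V)
  invFun := unipQFun (-(Q : V →L[ℝ] V))
  left_inv h := by rw [← unipQFun_add, neg_add_cancel, unipQFun_zero]
  right_inv h := by rw [← unipQFun_add, add_neg_cancel, unipQFun_zero]
  map_mul' := unipQFun_mul _ Q.2

/-- (Ported verbatim from the HodgeCMPerL package; no docstring in the source.) -/
@[simp] theorem unipQ_apply (Q : symOp V) (h : Heis V) : unipQ Q h = unipQFun (Q : V →L[ℝ] V) h := rfl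

/-- (Ported verbatim from the HodgeCMPerL package; no docstring in the source.) -/
theorem unipQ_zero : (unipQ (0 : symOp V)) = 1 := by
  ext h : 1
  rw [unipQ_apply, Submodule.coe_zero, unipQFun_zero, MulAut.one_apply]

/-- Additivity `n_{Q + Q'} = n_Q n_{Q'}`. -/
theorem unipQ_add (Q Q' : symOp V) : unipQ (Q + Q') = unipQ Q * unipQ Q' := by
  ext h : 1
  rw [MulAut.mul_apply, unipQ_apply, unipQ_apply, unipQ_apply, Submodule.coe_add, unipQFun_add]

/-- (Ported verbatim from the HodgeCMPerL package; no docstring in the source.) -/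
theorem unipQ_neg (Q : symOp V) : unipQ (-Q) = (unipQ Q)⁻¹ := by
  rw [eq_inv_iff_mul_eq_one, ← unipQ_add, neg_add_cancel, unipQ_zero]

/-- **`Q ↦ n_Q` is a homomorphism** `Sym(V) →* Aut(Heis V)`. -/
def unipQHom : Multiplicative (symOp V) →* MulAut (Heis V) where
  toFun Q := unipQ Q.toAdd
  map_one' := unipQ_zero
  map_mul' Q Q' := unipQ_add Q.toAdd Q'.toAdd

/-- (Ported verbatim from the HodgeCMPerL package; no docstring in the source.) -/
@[simp] theorem unipQHom_apply (Q : Multiplicative (symOp V)) : unipQHom Q = unipQ Q.toAdd := rfl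

/-- (Ported verbatim from the HodgeCMPerL package; no docstring in the source.) -/
theorem unipQ_center (Q : symOp V) (z : Circle) : unipQ Q (center z : Heis V) = center z := by
  ext
  · rfl
  · simp [center]
  · simp [center]

/-- The landed scalar shears are the case `Q = t • 1`: `n_t = n_{t • 1}`. -/
theorem unip_eq_unipQ (t : ℝ) : (unip t : MulAut (Heis V)) = unipQ ⟨t • 1, smul_one_mem_symOp V t⟩ := by
  ext h : 1
  rw [unip_apply, unipQ_apply]
  ext
  · rfl
  · simp
  · simp only [unipFun_u, unipQFun_u, FunLike.coe_smul, Pi.smul_apply, one_apply_eq_self,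
      real_inner_smul_left, real_inner_self_eq_norm_sq, mul_div_assoc]

end Heis

/-! ## `n_Q` under the Levi factor: `λ_A n_Q λ_A⁻¹ = n_{ᵗA⁻¹ Q A⁻¹}` -/

namespace Heis

variable {V : Type*} [NormedAddCommGroup V] [InnerProductSpace ℝ V] [FiniteDimensional ℝ V]

/-- The Levi action on `Sym(V)`: `A · Q = ᵗA⁻¹ ∘ Q ∘ A⁻¹`. -/
def leviSym (A : V ≃L[ℝ] V) (Q : symOp V) : symOp V :=
  ⟨LinearMap.toContinuousLinearMap
      (contragredient A ∘ₗ ((Q : V →L[ℝ] V) : V →ₗ[ℝ] V) ∘ₗ ((A.symm : V ≃L[ℝ] V) : V →ₗ[ℝ] V)), by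
    intro x y
    change ⟪contragredient A ((Q : V →L[ℝ] V) (A.symm x)), y⟫ = ⟪x, contragredient A ((Q : V →L[ℝ] V) (A.symm y))⟫
    rw [inner_contragredient_left, symOp.inner_apply_comm, real_inner_comm, ← inner_contragredient_left,
      real_inner_comm]⟩

/-- (Ported verbatim from the HodgeCMPerL package; no docstring in the source.) -/
theorem leviSym_apply (A : V ≃L[ℝ] V) (Q : symOp V) (x : V) :
    (leviSym A Q : V →L[ℝ] V) x = contragredient A ((Q : V →L[ℝ] V) (A.symm x)) := rfl

/-- **The Siegel parabolic is a semidirect product**: `λ_A n_Q λ_A⁻¹ = n_{ᵗA⁻¹ Q A⁻¹}` in `Aut(Heis V)`. -/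
theorem leviAut_mul_unipQ_mul_inv (A : V ≃L[ℝ] V) (Q : symOp V) :
    leviAut A * unipQ Q * (leviAut A)⁻¹ = unipQ (leviSym A Q) := by
  rw [← map_inv]
  ext h : 1
  rw [MulAut.mul_apply, MulAut.mul_apply, unipQ_apply, unipQ_apply, leviAut_apply, leviAut_apply]
  ext
  · exact A.apply_symm_apply h.a
  · simp only [unipQFun_b, leviSym_apply, map_add]
    congr 1
    -- `ᵗA⁻¹ (ᵗA b) = b`
    have h1 : contragredient A (contragredient A⁻¹ h.b) = h.b := by
      rw [← LinearMap.comp_apply, ← contragredient_mul, mul_inv_cancel, contragredient_one, LinearMap.id_apply]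
    simpa using h1
  · simp only [unipQFun_u, leviSym_apply, inner_contragredient_left]
    rfl

end Heis

/-! ## The symmetric chirps `𝐞(⟪Q x, x⟫/2)` on `𝓢(V, ℂ)` -/

section Chirp

variable (V : Type*) [NormedAddCommGroup V] [InnerProductSpace ℝ V]

/-- The quadratic form `x ↦ ⟪Q x, x⟫` has temperate growth. -/
theorem hasTemperateGrowth_quadForm (Q : V →L[ℝ] V) : (fun x : V => ⟪Q x, x⟫).HasTemperateGrowth := by
  exact (innerSL ℝ (E := V)).bilinear_hasTemperateGrowth Q.hasTemperateGrowth
    (ContinuousLinearMap.id ℝ V).hasTemperateGrowth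

/-- The symmetric chirp `x ↦ 𝐞(⟪Q x, x⟫/2)`. -/
def quadChirp (Q : V →L[ℝ] V) : V → ℂ := fun x => (𝐞 (⟪Q x, x⟫ / 2) : ℂ)

/-- (Ported verbatim from the HodgeCMPerL package; no docstring in the source.) -/
@[simp] theorem quadChirp_apply (Q : V →L[ℝ] V) (x : V) : quadChirp V Q x = (𝐞 (⟪Q x, x⟫ / 2) : ℂ) := rfl

/-- (Ported verbatim from the HodgeCMPerL package; no docstring in the source.) -/
theorem hasTemperateGrowth_quadChirp (Q : V →L[ℝ] V) : (quadChirp V Q).HasTemperateGrowth :=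
  hasTemperateGrowth_fourierChar.comp (f := fun x : V => ⟪Q x, x⟫ / 2)
    ((hasTemperateGrowth_quadForm V Q).mul (Function.HasTemperateGrowth.const _))

/-- **The symmetric chirp operator** `T_Q Φ = 𝐞(⟪Q·, ·⟫/2) Φ` on `𝓢(V, ℂ)`, for any `Q : V →L[ℝ] V`. -/
def chirpQ (Q : V →L[ℝ] V) : 𝓢(V, ℂ) →L[ℂ] 𝓢(V, ℂ) := SchwartzMap.smulLeftCLM ℂ (quadChirp V Q)

/-- (Ported verbatim from the HodgeCMPerL package; no docstring in the source.) -/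
@[simp] theorem chirpQ_apply (Q : V →L[ℝ] V) (Φ : 𝓢(V, ℂ)) (x : V) :
    chirpQ V Q Φ x = (𝐞 (⟪Q x, x⟫ / 2) : ℂ) * Φ x := by
  rw [chirpQ, SchwartzMap.smulLeftCLM_apply_apply (hasTemperateGrowth_quadChirp V Q), smul_eq_mul, quadChirp_apply]

/-- (Ported verbatim from the HodgeCMPerL package; no docstring in the source.) -/
theorem chirpQ_zero : chirpQ V 0 = ContinuousLinearMap.id ℂ 𝓢(V, ℂ) := by
  refine ContinuousLinearMap.ext fun Φ => ?_
  ext x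
  simp

/-- (Ported verbatim from the HodgeCMPerL package; no docstring in the source.) -/
theorem chirpQ_add (Q Q' : V →L[ℝ] V) : chirpQ V (Q + Q') = (chirpQ V Q).comp (chirpQ V Q') := by
  refine ContinuousLinearMap.ext fun Φ => ?_
  ext x
  simp only [chirpQ_apply, ContinuousLinearMap.comp_apply, add_apply, inner_add_left, add_div,
    AddChar.map_add_eq_mul, Circle.coe_mul, mul_assoc]

/-- (Ported verbatim from the HodgeCMPerL package; no docstring in the source.) -/
theorem chirpQ_neg_comp (Q : V →L[ℝ] V) : (chirpQ V (-Q)).comp (chirpQ V Q) = ContinuousLinearMap.id ℂ 𝓢(V, ℂ) := by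
  rw [← chirpQ_add, neg_add_cancel, chirpQ_zero]

/-- (Ported verbatim from the HodgeCMPerL package; no docstring in the source.) -/
theorem chirpQ_comp_neg (Q : V →L[ℝ] V) : (chirpQ V Q).comp (chirpQ V (-Q)) = ContinuousLinearMap.id ℂ 𝓢(V, ℂ) := by
  rw [← chirpQ_add, add_neg_cancel, chirpQ_zero]

/-- The landed scalar chirps: `T_c = chirpQ ((2c) • 1)`, i.e. `𝐞(c‖x‖²) = 𝐞(⟪2c x, x⟫/2)`. -/
theorem chirpCLM_eq_chirpQ (c : ℝ) : chirpCLM V c = chirpQ V ((2 * c) • (1 : V →L[ℝ] V)) := by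
  refine ContinuousLinearMap.ext fun Φ => ?_
  ext x
  simp only [chirpCLM_apply, chirpQ_apply, FunLike.coe_smul, Pi.smul_apply,
    one_apply_eq_self, real_inner_smul_left, real_inner_self_eq_norm_sq]
  ring_nf

/-- **The symmetric chirps as a homomorphism** `(V →L[ℝ] V, +) →* GL(𝓢(V, ℂ))`. -/
def chirpQUnit : Multiplicative (V →L[ℝ] V) →* (𝓢(V, ℂ) →L[ℂ] 𝓢(V, ℂ))ˣ where
  toFun Q :=
    { val := chirpQ V Q.toAdd
      inv := chirpQ V (-Q.toAdd)
      val_inv := by rw [ContinuousLinearMap.mul_def, chirpQ_comp_neg]; rfl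
      inv_val := by rw [ContinuousLinearMap.mul_def, chirpQ_neg_comp]; rfl }
  map_one' := Units.ext (by
    change chirpQ V 0 = 1
    rw [chirpQ_zero]; rfl)
  map_mul' Q Q' := Units.ext (by
    change chirpQ V (Q.toAdd + Q'.toAdd) = chirpQ V Q.toAdd * chirpQ V Q'.toAdd
    rw [ContinuousLinearMap.mul_def, chirpQ_add])

/-- (Ported verbatim from the HodgeCMPerL package; no docstring in the source.) -/
@[simp] theorem val_chirpQUnit (Q : Multiplicative (V →L[ℝ] V)) :
    (chirpQUnit V Q : 𝓢(V, ℂ) →L[ℂ] 𝓢(V, ℂ)) = chirpQ V Q.toAdd := rfl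

end Chirp

/-! ## Intertwining: `T_{mQ} ∘ ρ_m(h) = ρ_m(n_Q h) ∘ T_{mQ}` -/

section Intertwine

variable (V : Type) [NormedAddCommGroup V] [InnerProductSpace ℝ V] [FiniteDimensional ℝ V] [MeasurableSpace V]
  [BorelSpace V] (m : ℤ)

omit [FiniteDimensional ℝ V] [MeasurableSpace V] [BorelSpace V] in
/-- Phase bookkeeping: `⟪mQx, x⟫/2 + ⟪m b, x⟫ = m·(-⟪Qa, a⟫/2) + ⟪m (b + Q a), x⟫ + ⟪mQ(x - a), x - a⟫/2` (Q symmetric). -/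
theorem quadChirp_phase (Q : V →L[ℝ] V) (hQ : Q ∈ symOp V) (a b x : V) :
    ⟪((m : ℝ) • Q) x, x⟫ / 2 + ⟪(m : ℝ) • b, x⟫ =
      m • (-(⟪Q a, a⟫ / 2)) + (⟪(m : ℝ) • (b + Q a), x⟫ + ⟪((m : ℝ) • Q) (x - a), x - a⟫ / 2) := by
  simp only [FunLike.coe_smul, Pi.smul_apply, real_inner_smul_left, smul_add, inner_add_left, map_sub,
    inner_sub_left, inner_sub_right, zsmul_eq_mul]
  rw [hQ x a, real_inner_comm a (Q a), real_inner_comm x (Q a)]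
  ring

/-- **Intertwining** `T_{mQ} (ρ_m(h) Φ) = ρ_m(n_Q h) (T_{mQ} Φ)` for a symmetric `Q`. -/
theorem chirpQ_repCLM (Q : symOp V) (h : Heis V) (Φ : 𝓢(V, ℂ)) :
    chirpQ V ((m : ℝ) • (Q : V →L[ℝ] V)) (repCLM V m h Φ) =
      repCLM V m (Heis.unipQ Q h) (chirpQ V ((m : ℝ) • (Q : V →L[ℝ] V)) Φ) := by
  ext x
  simp only [chirpQ_apply, repCLM_apply, Heis.unipQ_apply, Heis.unipQFun_a, Heis.unipQFun_b, Heis.unipQFun_u,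
    Circle.coe_mul, mul_zpow, ← Circle.coe_zpow, ← AddChar.map_zsmul_eq_zpow]
  set Q' : V →L[ℝ] V := (m : ℝ) • (Q : V →L[ℝ] V) with hQ'
  calc (𝐞 (⟪Q' x, x⟫ / 2) : ℂ) * ((h.u : ℂ) ^ m * ((𝐞 ⟪(m : ℝ) • h.b, x⟫ : ℂ) * Φ (x - h.a)))
      = (h.u : ℂ) ^ m * (𝐞 (⟪Q' x, x⟫ / 2 + ⟪(m : ℝ) • h.b, x⟫) : ℂ) * Φ (x - h.a) := by
        rw [AddChar.map_add_eq_mul, Circle.coe_mul]; ring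
    _ = (h.u : ℂ) ^ m * (𝐞 (m • (-(⟪(Q : V →L[ℝ] V) h.a, h.a⟫ / 2)) + (⟪(m : ℝ) • (h.b + (Q : V →L[ℝ] V) h.a), x⟫
          + ⟪Q' (x - h.a), x - h.a⟫ / 2)) : ℂ) * Φ (x - h.a) := by rw [hQ', quadChirp_phase V m _ Q.2]
    _ = (h.u : ℂ) ^ m * ((𝐞 (m • (-(⟪(Q : V →L[ℝ] V) h.a, h.a⟫ / 2))) : Circle) : ℂ) *
          ((𝐞 ⟪(m : ℝ) • (h.b + (Q : V →L[ℝ] V) h.a), x⟫ : ℂ) * ((𝐞 (⟪Q' (x - h.a), x - h.a⟫ / 2) : ℂ)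
            * Φ (x - h.a))) := by
        rw [AddChar.map_add_eq_mul, AddChar.map_add_eq_mul, Circle.coe_mul, Circle.coe_mul]; ring

/-- The same law as an identity of operators. -/
theorem chirpQ_comp_repCLM (Q : symOp V) (h : Heis V) :
    (chirpQ V ((m : ℝ) • (Q : V →L[ℝ] V))).comp (repCLM V m h) =
      (repCLM V m (Heis.unipQ Q h)).comp (chirpQ V ((m : ℝ) • (Q : V →L[ℝ] V))) := by
  ext Φ : 1
  exact chirpQ_repCLM V m Q h Φ

/-- The weight-`m` chirp homomorphism `Sym(V) →* GL(𝓢(V, ℂ))`, `Q ↦ T_{mQ}`. -/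
def chirpQHom : Multiplicative (symOp V) →* (𝓢(V, ℂ) →L[ℂ] 𝓢(V, ℂ))ˣ :=
  (chirpQUnit V).comp (AddMonoidHom.toMultiplicative
    (((m : ℝ) • LinearMap.id : (V →L[ℝ] V) →ₗ[ℝ] (V →L[ℝ] V)).toAddMonoidHom.comp (symOp V).subtype.toAddMonoidHom))

omit [FiniteDimensional ℝ V] [MeasurableSpace V] [BorelSpace V] in
/-- (Ported verbatim from the HodgeCMPerL package; no docstring in the source.) -/
@[simp] theorem val_chirpQHom (Q : Multiplicative (symOp V)) :
    (chirpQHom V m Q : 𝓢(V, ℂ) →L[ℂ] 𝓢(V, ℂ)) = chirpQ V ((m : ℝ) • (Q.toAdd : V →L[ℝ] V)) := rfl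

/-- **The unipotent radical lies in the intertwining group**: `(n_Q, T_{mQ}) ∈ Mp_m(V)`. -/
theorem unipQ_mem_mpGroup (Q : symOp V) :
    (Heis.unipQ Q, chirpQHom V m (Multiplicative.ofAdd Q)) ∈ mpGroup V m := by
  intro h
  rw [eq_mul_inv_iff_mul_eq]
  refine Units.ext ?_
  simp only [Units.val_mul, val_repUnits, val_chirpQHom, toAdd_ofAdd, ContinuousLinearMap.mul_def]
  exact (chirpQ_comp_repCLM V m Q h).symm

/-- `Q ↦ (n_Q, T_{mQ})` is an intertwining lift of the unipotent radical. -/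
theorem intertwines_unipQ : Intertwines V m (Heis.unipQHom (V := V)) (chirpQHom V m) := fun Q h =>
  unipQ_mem_mpGroup V m Q.toAdd h

/-- The unipotent radical in the intertwining group: `Sym(V) →* Mp_m(V)`. -/
def unipQMp : Multiplicative (symOp V) →* mpGroup V m where
  toFun Q := ⟨(Heis.unipQ Q.toAdd, chirpQHom V m Q), unipQ_mem_mpGroup V m Q.toAdd⟩
  map_one' := Subtype.ext (Prod.ext Heis.unipQ_zero (map_one _))
  map_mul' Q Q' := Subtype.ext (Prod.ext (Heis.unipQ_add Q.toAdd Q'.toAdd) (map_mul _ Q Q'))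

/-- (Ported verbatim from the HodgeCMPerL package; no docstring in the source.) -/
@[simp] theorem mpProj_unipQMp (Q : Multiplicative (symOp V)) :
    mpProj V m (unipQMp V m Q) = Heis.unipQ Q.toAdd := rfl

/-- **Uniqueness up to a character**: any intertwining lift of the unipotent radical differs from `Q ↦ T_{mQ}` by a
character of `Sym(V)` (`m ≠ 0`). -/
theorem unipQ_unique_up_to_character (hm : m ≠ 0) {π : Multiplicative (symOp V) →* (𝓢(V, ℂ) →L[ℂ] 𝓢(V, ℂ))ˣ}
    (hπ : Intertwines V m (Heis.unipQHom (V := V)) π) :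
    ∃ c : Multiplicative (symOp V) →* ℂˣ, ∀ Q, π Q = scalarUnits V (c Q) * chirpQHom V m Q :=
  (intertwines_unipQ V m).exists_character hm hπ

end Intertwine

end SchwartzWeil
end HodgeCM

end
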